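import Mathlib
import Summits.CriticalPhenomena.CardyFormulaZ2.Theorems.CardyMagicRigidityDefs
import HarnessLib

/-!
# Crux `NestingRigidity`, line `positive-cone-weight-doubling`: the dyadic CELL GEOMETRY of the
# multi-scale bound (anchors, doubled cells, chessboard classes, cell ranges)

Crux `Summit.CriticalPhenomena.CardyFormulaZ2.Theses.CardyMagicRigidity.NestingRigidity`
(stmt-CriticalPhenomena-4835), line `positive-cone-weight-doubling`, registered helper Ξ
`uvFarBite_expMoment_latticeEnsembles`.  The multi-scale proof assigns every loop of diameter
`≤ h` to the grid cell (side `h`) containing the lower-left corner `(inf re, inf im)` of its bounding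
box; the loop then lies in the DOUBLED cell `[ih, (i+2)h] × [jh, (j+2)h]`, inside the window
`B(centre, 3h)`, and doubled cells of one of the `9` chessboard classes `(i mod 3, j mod 3)` are at
mutual distance `≥ h` (registered anchor `chessboard_separation`) — the separation under which the
inner-loop statistics of the two lattice ensembles are independent
(`iIndepFun_finsum_innerLoops_latticeEnsembles`, once `h > 2δ`).  Pure plane geometry, no lattice
input, no cited fact, NO definition: the cell data are written out (file-local notations `XI`, `YI`,
`IDX`, `BOX`, `CTR`, `CLS`, `RNG`, re-declared verbatim by the files using them).
-/

noncomputable section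

open Set Metric
open scoped Real Topology BigOperators

namespace Summit.CriticalPhenomena.CardyFormulaZ2.Cruxes.NestingRigidity.PositiveConeWeightDoubling

open Literature.Probability.RandomPlanarGeometry

/-- Abscissa of the left edge of the bounding box of a loop (local notation, not a definition). -/
local notation3 "XI[" u "]" => sInf (Complex.re '' UnbasedLoop.range u)
/-- Ordinate of the bottom edge of the bounding box of a loop (local notation). -/
local notation3 "YI[" u "]" => sInf (Complex.im '' UnbasedLoop.range u)
/-- The grid cell (side `h`) containing the lower-left corner of the bounding box (local notation). -/
local notation3 "IDX[" h ", " u "]" => ((⌊XI[u] / h⌋, ⌊YI[u] / h⌋) : ℤ × ℤ)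
/-- The doubled cell `[ih, (i+2)h] × [jh, (j+2)h]` of the grid cell `c = (i, j)` (local notation). -/
local notation3 "BOX[" h ", " c "]" => {z : ℂ | ((Prod.fst c : ℤ) : ℝ) * h ≤ z.re ∧
  z.re ≤ (((Prod.fst c : ℤ) : ℝ) + 2) * h ∧ ((Prod.snd c : ℤ) : ℝ) * h ≤ z.im ∧
  z.im ≤ (((Prod.snd c : ℤ) : ℝ) + 2) * h}
/-- The centre `((i+1)h, (j+1)h)` of the doubled cell (local notation). -/
local notation3 "CTR[" h ", " c "]" =>
  (Complex.mk ((((Prod.fst c : ℤ) : ℝ) + 1) * h) ((((Prod.snd c : ℤ) : ℝ) + 1) * h) : ℂ)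
/-- The cells that loops inside `B(x₀, ρ)` can be assigned to (local notation). -/
local notation3 "RNG[" h ", " x₀ ", " ρ "]" => (Finset.Icc ⌊(Complex.re x₀ - ρ) / h⌋ ⌊(Complex.re x₀ + ρ) / h⌋ ×ˢ
  Finset.Icc ⌊(Complex.im x₀ - ρ) / h⌋ ⌊(Complex.im x₀ + ρ) / h⌋ : Finset (ℤ × ℤ))

namespace UVFarBite

/-! ## §1 The anchor of a loop: the lower-left corner of its bounding box -/

/-- The left edge of the bounding box is attained on the (compact, nonempty) trace. -/
theorem exists_re_eq_xInf (u : UnbasedLoop ℂ) : ∃ p ∈ u.range, p.re = XI[u] ∧ ∀ z ∈ u.range, p.re ≤ z.re := by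
  obtain ⟨p, hp, hmin⟩ := u.isCompact_range.exists_isMinOn u.range_nonempty
    Complex.continuous_re.continuousOn
  have hmin' : ∀ z ∈ u.range, p.re ≤ z.re := fun z hz ↦ hmin hz
  refine ⟨p, hp, ?_, hmin'⟩
  refine (IsLeast.csInf_eq ⟨mem_image_of_mem _ hp, ?_⟩).symm
  rintro _ ⟨z, hz, rfl⟩
  exact hmin' z hz

/-- The bottom edge of the bounding box is attained on the trace. -/
theorem exists_im_eq_yInf (u : UnbasedLoop ℂ) : ∃ p ∈ u.range, p.im = YI[u] ∧ ∀ z ∈ u.range, p.im ≤ z.im := by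
  obtain ⟨p, hp, hmin⟩ := u.isCompact_range.exists_isMinOn u.range_nonempty
    Complex.continuous_im.continuousOn
  have hmin' : ∀ z ∈ u.range, p.im ≤ z.im := fun z hz ↦ hmin hz
  refine ⟨p, hp, ?_, hmin'⟩
  refine (IsLeast.csInf_eq ⟨mem_image_of_mem _ hp, ?_⟩).symm
  rintro _ ⟨z, hz, rfl⟩
  exact hmin' z hz

/-- Every trace point has abscissa in `[XI, XI + diam]`. -/
theorem re_mem_Icc {u : UnbasedLoop ℂ} {z : ℂ} (hz : z ∈ u.range) :
    XI[u] ≤ z.re ∧ z.re ≤ XI[u] + diam u.range := by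
  obtain ⟨p, hp, hpx, hmin⟩ := exists_re_eq_xInf u
  refine ⟨hpx ▸ hmin z hz, ?_⟩
  have h1 : (z - p).re ≤ ‖z - p‖ := (le_abs_self _).trans (Complex.abs_re_le_norm _)
  have h2 : ‖z - p‖ ≤ diam u.range := by
    rw [← dist_eq_norm]; exact dist_le_diam_of_mem u.isCompact_range.isBounded hz hp
  rw [Complex.sub_re] at h1
  linarith

/-- Every trace point has ordinate in `[YI, YI + diam]`. -/
theorem im_mem_Icc {u : UnbasedLoop ℂ} {z : ℂ} (hz : z ∈ u.range) :
    YI[u] ≤ z.im ∧ z.im ≤ YI[u] + diam u.range := by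
  obtain ⟨p, hp, hpy, hmin⟩ := exists_im_eq_yInf u
  refine ⟨hpy ▸ hmin z hz, ?_⟩
  have h1 : (z - p).im ≤ ‖z - p‖ := (le_abs_self _).trans (Complex.abs_im_le_norm _)
  have h2 : ‖z - p‖ ≤ diam u.range := by
    rw [← dist_eq_norm]; exact dist_le_diam_of_mem u.isCompact_range.isBounded hz hp
  rw [Complex.sub_im] at h1
  linarith

/-- A loop inside `B(x₀, ρ)` has diameter `≤ 2ρ`. -/
theorem diam_le_two_mul {u : UnbasedLoop ℂ} {x₀ : ℂ} {ρ : ℝ} (hρ : 0 ≤ ρ) (hu : u.range ⊆ ball x₀ ρ) :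
    diam u.range ≤ 2 * ρ :=
  (diam_mono hu isBounded_ball).trans (diam_ball hρ)

/-! ## §2 Cells: the doubled cell of a small loop, its window, the cell range -/

/-- `⌊x/h⌋ h ≤ x < (⌊x/h⌋ + 1) h` for `h > 0`. -/
theorem floor_mul_le_and_lt {h : ℝ} (hh : 0 < h) (x : ℝ) :
    (⌊x / h⌋ : ℝ) * h ≤ x ∧ x < ((⌊x / h⌋ : ℝ) + 1) * h := by
  constructor
  · have := Int.floor_le (x / h)
    calc (⌊x / h⌋ : ℝ) * h ≤ x / h * h := mul_le_mul_of_nonneg_right this hh.le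
      _ = x := div_mul_cancel₀ x hh.ne'
  · have := Int.lt_floor_add_one (x / h)
    calc x = x / h * h := (div_mul_cancel₀ x hh.ne').symm
      _ < ((⌊x / h⌋ : ℝ) + 1) * h := mul_lt_mul_of_pos_right this hh

/-- **A loop of diameter `≤ h` lies in the doubled cell of its grid cell.** -/
theorem range_subset_cellBox {h : ℝ} (hh : 0 < h) {u : UnbasedLoop ℂ} (hd : diam u.range ≤ h) :
    u.range ⊆ BOX[h, IDX[h, u]] := by
  intro z hz
  obtain ⟨hx1, hx2⟩ := re_mem_Icc hz
  obtain ⟨hy1, hy2⟩ := im_mem_Icc hz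
  obtain ⟨fx1, fx2⟩ := floor_mul_le_and_lt hh XI[u]
  obtain ⟨fy1, fy2⟩ := floor_mul_le_and_lt hh YI[u]
  simp only [mem_setOf_eq]
  refine ⟨by linarith, ?_, by linarith, ?_⟩ <;> nlinarith

/-- **The doubled cell lies in the window `B(centre, 3h)`.** -/
theorem cellBox_subset_ball {h : ℝ} (hh : 0 < h) (c : ℤ × ℤ) : BOX[h, c] ⊆ ball CTR[h, c] (3 * h) := by
  rintro z ⟨h1, h2, h3, h4⟩
  rw [mem_ball, dist_eq_norm]
  refine (Complex.norm_le_abs_re_add_abs_im _).trans_lt ?_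
  simp only [Complex.sub_re, Complex.sub_im]
  have hre : |z.re - ((c.1 : ℝ) + 1) * h| ≤ h := abs_le.2 ⟨by linarith, by linarith⟩
  have him : |z.im - ((c.2 : ℝ) + 1) * h| ≤ h := abs_le.2 ⟨by linarith, by linarith⟩
  linarith

/-- **A loop of diameter `≤ h` with cell index `c` lies in the window `B(centre c, 3h)`.** -/
theorem range_subset_ball_cellCentre {h : ℝ} (hh : 0 < h) {u : UnbasedLoop ℂ} (hd : diam u.range ≤ h)
    {c : ℤ × ℤ} (hc : IDX[h, u] = c) : u.range ⊆ ball CTR[h, c] (3 * h) :=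
  hc ▸ (range_subset_cellBox hh hd).trans (cellBox_subset_ball hh _)

/-- **A loop inside `B(x₀, ρ)` is indexed by a cell of the cell range.** -/
theorem cellIdx_mem_cellRange {h : ℝ} (hh : 0 < h) {x₀ : ℂ} {ρ : ℝ} {u : UnbasedLoop ℂ}
    (hu : u.range ⊆ ball x₀ ρ) : IDX[h, u] ∈ RNG[h, x₀, ρ] := by
  obtain ⟨p, hp, hpx, -⟩ := exists_re_eq_xInf u
  obtain ⟨q, hq, hqy, -⟩ := exists_im_eq_yInf u
  have hp' := mem_ball.1 (hu hp)
  have hq' := mem_ball.1 (hu hq)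
  rw [dist_eq_norm] at hp' hq'
  have h1 : |(p - x₀).re| < ρ := (Complex.abs_re_le_norm _).trans_lt hp'
  have h2 : |(q - x₀).im| < ρ := (Complex.abs_im_le_norm _).trans_lt hq'
  rw [Complex.sub_re, abs_lt] at h1
  rw [Complex.sub_im, abs_lt] at h2
  simp only [Finset.mem_product, Finset.mem_Icc]
  refine ⟨⟨Int.floor_le_floor ?_, Int.floor_le_floor ?_⟩, ⟨Int.floor_le_floor ?_, Int.floor_le_floor ?_⟩⟩
  · exact div_le_div_of_nonneg_right (by linarith) hh.le
  · exact div_le_div_of_nonneg_right (by linarith) hh.le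
  · exact div_le_div_of_nonneg_right (by linarith) hh.le
  · exact div_le_div_of_nonneg_right (by linarith) hh.le

/-- The number of integers in `[⌊(x−ρ)/h⌋, ⌊(x+ρ)/h⌋]` is at most `2ρ/h + 2`. -/
theorem card_Icc_floor_le {h : ℝ} (hh : 0 < h) (x : ℝ) {ρ : ℝ} (hρ : 0 ≤ ρ) :
    ((Finset.Icc ⌊(x - ρ) / h⌋ ⌊(x + ρ) / h⌋).card : ℝ) ≤ 2 * ρ / h + 2 := by
  rw [Int.card_Icc]
  set m : ℤ := ⌊(x + ρ) / h⌋ + 1 - ⌊(x - ρ) / h⌋ with hm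
  have hm_le : (m : ℝ) ≤ 2 * ρ / h + 2 := by
    have e1 : (⌊(x + ρ) / h⌋ : ℝ) ≤ (x + ρ) / h := Int.floor_le _
    have e2 : (x - ρ) / h < (⌊(x - ρ) / h⌋ : ℝ) + 1 := Int.lt_floor_add_one _
    have e3 : (x + ρ) / h - (x - ρ) / h = 2 * ρ / h := by ring
    rw [hm]; push_cast; linarith
  rcases le_or_gt 0 m with h0 | h0
  · have : ((m.toNat : ℕ) : ℝ) = (m : ℝ) := by exact_mod_cast Int.toNat_of_nonneg h0
    rw [this]; exact hm_le
  · have : m.toNat = 0 := Int.toNat_eq_zero.2 h0.le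
    rw [this]; push_cast; positivity

/-- **The cell range of `B(x₀, ρ)` at side `h` has at most `(2ρ/h + 2)²` cells.** -/
theorem card_cellRange_le {h : ℝ} (hh : 0 < h) (x₀ : ℂ) {ρ : ℝ} (hρ : 0 ≤ ρ) :
    ((RNG[h, x₀, ρ]).card : ℝ) ≤ (2 * ρ / h + 2) ^ 2 := by
  rw [Finset.card_product, Nat.cast_mul, sq]
  exact mul_le_mul (card_Icc_floor_le hh _ hρ) (card_Icc_floor_le hh _ hρ) (Nat.cast_nonneg _)
    (by positivity)

/-- Every window `B(centre c, 3h)` of a cell of the range of `B(x₀, ρ)` lies in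
`B(0, ‖x₀‖ + 2ρ + 7h)` (so that the fixed-mesh finiteness of loop families inside `B(0, R)` applies). -/
theorem ball_cellCentre_subset {h : ℝ} (hh : 0 < h) {x₀ : ℂ} {ρ : ℝ} {c : ℤ × ℤ}
    (hc : c ∈ RNG[h, x₀, ρ]) :
    ball CTR[h, c] (3 * h) ⊆ ball (0 : ℂ) (‖x₀‖ + 2 * ρ + 7 * h) := by
  simp only [Finset.mem_product, Finset.mem_Icc] at hc
  obtain ⟨⟨h1, h2⟩, ⟨h3, h4⟩⟩ := hc
  have f1 := (floor_mul_le_and_lt hh (x₀.re - ρ)).2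
  have f2 := (floor_mul_le_and_lt hh (x₀.re + ρ)).1
  have f3 := (floor_mul_le_and_lt hh (x₀.im - ρ)).2
  have f4 := (floor_mul_le_and_lt hh (x₀.im + ρ)).1
  have h1' : (⌊(x₀.re - ρ) / h⌋ : ℝ) ≤ c.1 := by exact_mod_cast h1
  have h2' : (c.1 : ℝ) ≤ ⌊(x₀.re + ρ) / h⌋ := by exact_mod_cast h2
  have h3' : (⌊(x₀.im - ρ) / h⌋ : ℝ) ≤ c.2 := by exact_mod_cast h3
  have h4' : (c.2 : ℝ) ≤ ⌊(x₀.im + ρ) / h⌋ := by exact_mod_cast h4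
  have hre : |((c.1 : ℝ) + 1) * h - x₀.re| ≤ ρ + 2 * h := abs_le.2 ⟨by nlinarith, by nlinarith⟩
  have him : |((c.2 : ℝ) + 1) * h - x₀.im| ≤ ρ + 2 * h := abs_le.2 ⟨by nlinarith, by nlinarith⟩
  intro z hz
  rw [mem_ball, dist_zero_right]
  rw [mem_ball, dist_eq_norm] at hz
  have hcx : ‖CTR[h, c] - x₀‖ ≤ 2 * ρ + 4 * h := by
    refine (Complex.norm_le_abs_re_add_abs_im _).trans ?_
    rw [Complex.sub_re, Complex.sub_im]
    change |((c.1 : ℝ) + 1) * h - x₀.re| + |((c.2 : ℝ) + 1) * h - x₀.im| ≤ _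
    linarith
  calc ‖z‖ = ‖(z - CTR[h, c]) + (CTR[h, c] - x₀) + x₀‖ := by congr 1; ring
    _ ≤ ‖z - CTR[h, c]‖ + ‖CTR[h, c] - x₀‖ + ‖x₀‖ := norm_add₃_le
    _ < 3 * h + (2 * ρ + 4 * h) + ‖x₀‖ := by linarith
    _ = _ := by ring

end UVFarBite

/-! ## §3 Chessboard separation (registered anchor) -/

/-- **Chessboard separation** (helper toward Ξ `uvFarBite_expMoment_latticeEnsembles`, line
`positive-cone-weight-doubling`; the geometric input of the chessboard independence of one dyadic
scale): two DISTINCT doubled cells `[ih, (i+2)h] × [jh, (j+2)h]`, `[i'h, (i'+2)h] × [j'h, (j'+2)h]` of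
the same chessboard class (`i ≡ i'`, `j ≡ j' (mod 3)`) are at distance `≥ h`: congruent distinct
indices differ by at least `3`, so the cells are separated by a full cell in one coordinate. -/
theorem chessboard_separation : ∀ (h : ℝ) (c c' : ℤ × ℤ) (p q : ℂ), 0 ≤ h → c ≠ c' →
    c.1 % 3 = c'.1 % 3 → c.2 % 3 = c'.2 % 3 →
    (c.1 : ℝ) * h ≤ p.re → p.re ≤ ((c.1 : ℝ) + 2) * h → (c.2 : ℝ) * h ≤ p.im → p.im ≤ ((c.2 : ℝ) + 2) * h →
    (c'.1 : ℝ) * h ≤ q.re → q.re ≤ ((c'.1 : ℝ) + 2) * h → (c'.2 : ℝ) * h ≤ q.im →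
    q.im ≤ ((c'.2 : ℝ) + 2) * h → h ≤ dist p q := by
  intro h c c' p q hh hne h1 h2 hp1 hp2 hp3 hp4 hq1 hq2 hq3 hq4
  rw [dist_eq_norm]
  have hre : |(p - q).re| ≤ ‖p - q‖ := Complex.abs_re_le_norm _
  have him : |(p - q).im| ≤ ‖p - q‖ := Complex.abs_im_le_norm _
  rw [Complex.sub_re] at hre
  rw [Complex.sub_im] at him
  by_cases hc1 : c.1 = c'.1
  · have hc2 : c.2 ≠ c'.2 := fun h' ↦ hne (Prod.ext hc1 h')
    have hgap : c.2 + 3 ≤ c'.2 ∨ c'.2 + 3 ≤ c.2 := by omega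
    rcases hgap with hg | hg
    · have hg' : (c.2 : ℝ) + 3 ≤ c'.2 := by exact_mod_cast hg
      have : h ≤ q.im - p.im := by nlinarith
      linarith [le_abs_self (p.im - q.im), neg_abs_le (p.im - q.im)]
    · have hg' : (c'.2 : ℝ) + 3 ≤ c.2 := by exact_mod_cast hg
      have : h ≤ p.im - q.im := by nlinarith
      linarith [le_abs_self (p.im - q.im)]
  · have hgap : c.1 + 3 ≤ c'.1 ∨ c'.1 + 3 ≤ c.1 := by omega
    rcases hgap with hg | hg
    · have hg' : (c.1 : ℝ) + 3 ≤ c'.1 := by exact_mod_cast hg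
      have : h ≤ q.re - p.re := by nlinarith
      linarith [le_abs_self (p.re - q.re), neg_abs_le (p.re - q.re)]
    · have hg' : (c'.1 : ℝ) + 3 ≤ c.1 := by exact_mod_cast hg
      have : h ≤ p.re - q.re := by nlinarith
      linarith [le_abs_self (p.re - q.re)]

namespace UVFarBite

/-- Cells of one chessboard class (`Fin 9`-valued class map `(i mod 3, j mod 3)`) have congruent
coordinates mod `3`. -/
theorem emod_eq_of_cls_eq {c c' : ℤ × ℤ}
    (hcl : (3 * (c.1 % 3) + c.2 % 3).toNat = (3 * (c'.1 % 3) + c'.2 % 3).toNat) :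
    c.1 % 3 = c'.1 % 3 ∧ c.2 % 3 = c'.2 % 3 := by
  omega

/-- **Distinct doubled cells of one chessboard class are more than `2δ` apart once `h > 2δ`** (the
separation hypothesis of `iIndepFun_finsum_innerLoops_latticeEnsembles`, for any sub-regions of the
doubled cells). -/
theorem two_mul_lt_dist_of_cls_eq {h δ : ℝ} (hδ : 0 ≤ δ) (hhδ : 2 * δ < h) {c c' : ℤ × ℤ}
    (hne : c ≠ c') (hcl : (3 * (c.1 % 3) + c.2 % 3).toNat = (3 * (c'.1 % 3) + c'.2 % 3).toNat)
    {p q : ℂ} (hp : p ∈ BOX[h, c]) (hq : q ∈ BOX[h, c']) : 2 * δ < dist p q := by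
  obtain ⟨h1, h2⟩ := emod_eq_of_cls_eq hcl
  obtain ⟨hp1, hp2, hp3, hp4⟩ := hp
  obtain ⟨hq1, hq2, hq3, hq4⟩ := hq
  exact hhδ.trans_le
    (chessboard_separation h c c' p q (by linarith) hne h1 h2 hp1 hp2 hp3 hp4 hq1 hq2 hq3 hq4)

end UVFarBite

end Summit.CriticalPhenomena.CardyFormulaZ2.Cruxes.NestingRigidity.PositiveConeWeightDoubling

end
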